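import Literature.MathematicalPhysics.KineticTheory.LambertianRedrawNondegenerate
import Literature.Analysis.FluidPDE.HardSphereFlowRestart

/-!
# Restarting the Lambertian hard-sphere recursion: truncated forward regularity

Helper file (`--supports`) of the support item `LambertianWellPosed` of route `LambertianContactSwap`
(`AtomisticToContinuum/HydrodynamicLimit`, stmt-AtomisticToContinuum-12101). Port to the Lambertian
recursion `lambertStateAfter / lambertInstant / lambertFlow` of
`Literature.MathematicalPhysics.KineticTheory.LambertianHardSphereFlow` (noise sequence `ξs`, the `k`-th
collision redrawn with `ξs k`) of the deterministic restart kit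
`Literature.Analysis.FluidPDE.HardSphereFlowRestart`:

* the Lambertian step does not change along a free flight (`lambertStep_freeFlight`);
* restart of the states, instants and flow after time `s` in a collision segment `t_k ≤ s < t_{k+1}`:
  the recursion restarted at `Λ_s(z; ξs)` and driven by the SHIFTED noise `n ↦ ξs (n + k)` reproduces the
  later states and instants (`lambertStateAfter_lambertFlow_succ`, `lambertInstant_lambertFlow_succ_add`,
  `lambertFlow_add_of_segment`);
* truncated forward regularity up to a horizon `T` — the three clauses (simple incoming exits at the
  instants `≤ T`, no grazing touch inside the free flights before `T`, some instant beyond `T`), written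
  inline — is monotone, gives collision segments, is ADDITIVE under restart
  (`lambert_fwdGoodUpTo_add`), and at every integer horizon implies the three untruncated clauses of the
  route item (`lambert_fwdGood_of_forall`).

All statements hold for an arbitrary geometry; no measure theory here.
-/

noncomputable section

open MeasureTheory Set Function Filter
open scoped ENNReal

namespace Summit.AtomisticToContinuum.HydrodynamicLimit.Theorems

open Literature.MathematicalPhysics.KineticTheory Literature.Analysis.FluidPDE
  Literature.Analysis.FluidPDE.Alexander

namespace LRestart

variable {d : Type*} [Fintype d] {X : Type*} {N : ℕ} {G : Geometry d X} {ε : ℝ}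

/-! ## The step along a free flight; frozen dynamics -/

/-- Along a free flight the Lambertian step does not change: `L_ξ (S_s z) = L_ξ z` for
`0 ≤ s ≤ τ(z) < ∞`. [folklore] -/
theorem lambertStep_freeFlight {z : Config N d X} {s : ℝ} (hs : 0 ≤ s)
    (h : ENNReal.ofReal s ≤ freeExitTime G ε z) (hτ : freeExitTime G ε z ≠ ∞) (ξ : EuclideanSpace ℝ d) :
    lambertStep G ε ξ (freeFlight G s z) = lambertStep G ε ξ z := by
  have h1 := freeExitTime_freeFlight_add (G := G) (ε := ε) hs h
  have hτ' : freeExitTime G ε (freeFlight G s z) ≠ ∞ := by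
    intro htop; rw [htop, top_add] at h1; exact hτ h1.symm
  rw [lambertStep_of_ne_top hτ', lambertStep_of_ne_top hτ, freeFlight_freeExitTime_freeFlight hs h hτ]

/-- After a free flight that never ends the Lambertian recursion is frozen:
`τ(z_m) = ∞ ⇒ z_k = z_m` for `k ≥ m`. [folklore] -/
theorem lambertStateAfter_eq_of_top {ξs : ℕ → EuclideanSpace ℝ d} {z : Config N d X} {m : ℕ}
    (hm : freeExitTime G ε (lambertStateAfter G ε ξs z m) = ∞) {k : ℕ} (hmk : m ≤ k) :
    lambertStateAfter G ε ξs z k = lambertStateAfter G ε ξs z m := by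
  induction k with
  | zero => rw [Nat.le_zero.1 hmk]
  | succ k ih =>
    rcases Nat.of_le_succ hmk with hle | rfl
    · rw [lambertStateAfter_succ, ih hle, lambertStep_of_eq_top hm]
    · rfl

/-- Every state is a state reached at a finite instant: for each `k` there is `m ≤ k` with `t_m < ∞`
and `z_k = z_m`. [folklore] -/
theorem exists_lambertStateAfter_eq_reachable (ξs : ℕ → EuclideanSpace ℝ d) (z : Config N d X) (k : ℕ) :
    ∃ m ≤ k, lambertInstant G ε ξs z m ≠ ∞ ∧ lambertStateAfter G ε ξs z k = lambertStateAfter G ε ξs z m := by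
  classical
  let P : ℕ → Prop := fun m => freeExitTime G ε (lambertStateAfter G ε ξs z m) = ∞ ∨ m = k
  have hP : ∃ m, P m := ⟨k, Or.inr rfl⟩
  refine ⟨Nat.find hP, Nat.find_min' hP (Or.inr rfl), ?_, ?_⟩
  · rw [lambertInstant_ne_top_iff]
    intro m hm htop
    exact Nat.find_min hP hm (Or.inl htop)
  · rcases (Nat.find_spec hP : P (Nat.find hP)) with htop | heq
    · exact lambertStateAfter_eq_of_top htop (Nat.find_min' hP (Or.inr rfl))
    · rw [heq]

/-! ## Restarting the recursion from a point of the orbit -/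

/-- Segment arithmetic in `ℝ≥0∞`: `a ≤ s < a + b` (reals `s ≥ 0`) gives `a < ∞`, `a ≤ s`,
`s - a < b` and `a + (s - a) = s`. [folklore] -/
theorem segment_arith' {a b : ℝ≥0∞} {s : ℝ} (hs : 0 ≤ s) (h1 : a ≤ ENNReal.ofReal s)
    (h2 : ENNReal.ofReal s < a + b) :
    a ≠ ∞ ∧ a.toReal ≤ s ∧ ENNReal.ofReal (s - a.toReal) < b ∧
      a + ENNReal.ofReal (s - a.toReal) = ENNReal.ofReal s := by
  have hfin : a ≠ ∞ := ne_top_of_le_ne_top ENNReal.ofReal_ne_top h1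
  have hle : a.toReal ≤ s := ENNReal.toReal_le_of_le_ofReal hs h1
  have hsplit : a + ENNReal.ofReal (s - a.toReal) = ENNReal.ofReal s := by
    rw [← ENNReal.ofReal_toReal hfin, ENNReal.toReal_ofReal ENNReal.toReal_nonneg,
      ← ENNReal.ofReal_add ENNReal.toReal_nonneg (sub_nonneg.2 hle), add_sub_cancel]
  refine ⟨hfin, hle, ?_, hsplit⟩
  rw [← hsplit] at h2
  exact (ENNReal.add_lt_add_iff_left hfin).1 h2

/-- The recursion started at a point `S_u w` of the first free flight of `w` agrees with the recursion
from `w` from the first collision on (`0 ≤ u ≤ τ(w) < ∞`). [folklore] -/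
theorem lambertStateAfter_freeFlight_succ {w : Config N d X} {u : ℝ} (hu : 0 ≤ u)
    (h : ENNReal.ofReal u ≤ freeExitTime G ε w) (hτ : freeExitTime G ε w ≠ ∞)
    (η : ℕ → EuclideanSpace ℝ d) (m : ℕ) :
    lambertStateAfter G ε η (freeFlight G u w) (m + 1) = lambertStateAfter G ε η w (m + 1) := by
  rw [lambertStateAfter_succ_eq_tail, lambertStateAfter_succ_eq_tail, lambertStep_freeFlight hu h hτ]

variable {ξs : ℕ → EuclideanSpace ℝ d} {z : Config N d X} {s : ℝ} {k : ℕ}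

/-- **Restart, states**: if `t_k ≤ s < t_{k+1}` and `τ(z_k) < ∞`, the recursion restarted at
`Λ_s z = S_{s - t_k} z_k` and driven by the shifted noise `n ↦ ξs (n + k)` has states
`w_{m+1} = z_{k+m+1}`. [folklore] -/
theorem lambertStateAfter_lambertFlow_succ (hs : 0 ≤ s)
    (h1 : lambertInstant G ε ξs z k ≤ ENNReal.ofReal s)
    (h2 : ENNReal.ofReal s < lambertInstant G ε ξs z (k + 1))
    (hτ : freeExitTime G ε (lambertStateAfter G ε ξs z k) ≠ ∞) (m : ℕ) :
    lambertStateAfter G ε (fun n => ξs (n + k)) (lambertFlow G ε ξs z s) (m + 1) =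
      lambertStateAfter G ε ξs z (k + (m + 1)) := by
  rw [lambertInstant_succ] at h2
  obtain ⟨-, hle, hlt, -⟩ := segment_arith' hs h1 h2
  rw [lambertFlow_eq_of_segment h1 (by rwa [lambertInstant_succ]),
    lambertStateAfter_freeFlight_succ (sub_nonneg.2 hle) hlt.le hτ, lambertStateAfter_add ξs z k (m + 1)]

/-- **Restart, instants**: if `t_k ≤ s < t_{k+1}`, the instants of the restarted recursion are the
later instants shifted by `s`: `t^w_{m+1} + s = t_{k+m+1}`. [folklore] -/
theorem lambertInstant_lambertFlow_succ_add (hs : 0 ≤ s)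
    (h1 : lambertInstant G ε ξs z k ≤ ENNReal.ofReal s)
    (h2 : ENNReal.ofReal s < lambertInstant G ε ξs z (k + 1)) (m : ℕ) :
    lambertInstant G ε (fun n => ξs (n + k)) (lambertFlow G ε ξs z s) (m + 1) + ENNReal.ofReal s =
      lambertInstant G ε ξs z (k + (m + 1)) := by
  have h2' := h2
  rw [lambertInstant_succ] at h2'
  obtain ⟨hfin, hle, hlt, hsplit⟩ := segment_arith' hs h1 h2'
  have hw : lambertFlow G ε ξs z s =
      freeFlight G (s - (lambertInstant G ε ξs z k).toReal) (lambertStateAfter G ε ξs z k) :=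
    lambertFlow_eq_of_segment h1 h2
  have hshift : freeExitTime G ε (lambertFlow G ε ξs z s) +
      ENNReal.ofReal (s - (lambertInstant G ε ξs z k).toReal) =
        freeExitTime G ε (lambertStateAfter G ε ξs z k) := by
    rw [hw]; exact freeExitTime_freeFlight_add (sub_nonneg.2 hle) hlt.le
  induction m with
  | zero =>
    rw [zero_add, lambertInstant_one, lambertInstant_succ, ← hshift, ← hsplit]
    ring
  | succ m ih =>
    by_cases hτ : freeExitTime G ε (lambertStateAfter G ε ξs z k) = ∞
    · -- frozen dynamics: all later instants are infinite on both sides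
      have hw' : freeExitTime G ε (lambertFlow G ε ξs z s) = ∞ := by
        rw [hw]; exact freeExitTime_freeFlight_eq_top (sub_nonneg.2 hle) hτ
      have hl : lambertInstant G ε (fun n => ξs (n + k)) (lambertFlow G ε ξs z s) (m + 1 + 1) = ∞ := by
        refine top_unique ?_
        calc (⊤ : ℝ≥0∞) = lambertInstant G ε (fun n => ξs (n + k)) (lambertFlow G ε ξs z s) 1 := by
              rw [lambertInstant_one, hw']
          _ ≤ _ := monotone_lambertInstant _ _ (by omega)
      have hr : lambertInstant G ε ξs z (k + (m + 1 + 1)) = ∞ := by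
        refine top_unique ?_
        calc (⊤ : ℝ≥0∞) = lambertInstant G ε ξs z (k + 1) := by
              rw [lambertInstant_succ, hτ, add_top]
          _ ≤ _ := monotone_lambertInstant _ _ (by omega)
      rw [hl, hr, top_add]
    · rw [lambertInstant_succ, lambertStateAfter_lambertFlow_succ hs h1 h2 hτ m, add_right_comm, ih,
        show k + (m + 1 + 1) = (k + (m + 1)) + 1 by omega, lambertInstant_succ]

/-- **Restart, the flow**: `Λ_{s+u}(z; ξs) = Λ_u(Λ_s(z; ξs); ξs (· + k))` for `s, u ≥ 0`, as soon as `s`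
lies in the `k`-th collision segment of `z` and `u` in a collision segment of the restarted recursion.
[folklore] -/
theorem lambertFlow_add_of_segment (hs : 0 ≤ s) {u : ℝ} (hu : 0 ≤ u)
    (h1 : lambertInstant G ε ξs z k ≤ ENNReal.ofReal s)
    (h2 : ENNReal.ofReal s < lambertInstant G ε ξs z (k + 1)) {m : ℕ}
    (h1' : lambertInstant G ε (fun n => ξs (n + k)) (lambertFlow G ε ξs z s) m ≤ ENNReal.ofReal u)
    (h2' : ENNReal.ofReal u < lambertInstant G ε (fun n => ξs (n + k)) (lambertFlow G ε ξs z s) (m + 1)) :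
    lambertFlow G ε ξs z (s + u) = lambertFlow G ε (fun n => ξs (n + k)) (lambertFlow G ε ξs z s) u := by
  have h2'' := h2
  rw [lambertInstant_succ] at h2''
  obtain ⟨hfin, hle, hlt, hsplit⟩ := segment_arith' hs h1 h2''
  have hsu : ENNReal.ofReal (s + u) = ENNReal.ofReal u + ENNReal.ofReal s := by
    rw [add_comm, ENNReal.ofReal_add hu hs]
  rw [lambertFlow_eq_of_segment h1' h2']
  rcases Nat.eq_zero_or_pos m with rfl | hm
  · -- still in the first free flight of the restarted recursion
    have hA : lambertInstant G ε ξs z k ≤ ENNReal.ofReal (s + u) :=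
      h1.trans (ENNReal.ofReal_le_ofReal (by linarith))
    have hB : ENNReal.ofReal (s + u) < lambertInstant G ε ξs z (k + 1) := by
      rw [hsu, ← lambertInstant_lambertFlow_succ_add hs h1 h2 0]
      exact ENNReal.add_lt_add_right ENNReal.ofReal_ne_top h2'
    rw [lambertFlow_eq_of_segment hA hB, lambertStateAfter_zero, lambertInstant_zero, ENNReal.toReal_zero,
      sub_zero, lambertFlow_eq_of_segment h1 h2, ← freeFlight_add]
    congr 1
    ring
  · obtain ⟨m, rfl⟩ := Nat.exists_eq_add_one_of_ne_zero hm.ne'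
    have hinst := lambertInstant_lambertFlow_succ_add hs h1 h2 m
    have hA : lambertInstant G ε ξs z (k + (m + 1)) ≤ ENNReal.ofReal (s + u) := by
      rw [hsu, ← hinst]
      exact add_le_add h1' le_rfl
    have hB : ENNReal.ofReal (s + u) < lambertInstant G ε ξs z (k + (m + 1) + 1) := by
      rw [hsu, show k + (m + 1) + 1 = k + (m + 1 + 1) by omega,
        ← lambertInstant_lambertFlow_succ_add hs h1 h2 (m + 1)]
      exact ENNReal.add_lt_add_right ENNReal.ofReal_ne_top h2'
    have hfin' : lambertInstant G ε (fun n => ξs (n + k)) (lambertFlow G ε ξs z s) (m + 1) ≠ ∞ :=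
      ne_top_of_le_ne_top ENNReal.ofReal_ne_top h1'
    have hτ : freeExitTime G ε (lambertStateAfter G ε ξs z k) ≠ ∞ := by
      intro htop
      have : lambertInstant G ε ξs z (k + (m + 1)) = ∞ := by
        refine top_unique ?_
        calc (⊤ : ℝ≥0∞) = lambertInstant G ε ξs z (k + 1) := by
              rw [lambertInstant_succ, htop, add_top]
          _ ≤ _ := monotone_lambertInstant _ _ (by omega)
      rw [this] at hA
      exact ENNReal.ofReal_ne_top (top_unique hA)
    rw [lambertFlow_eq_of_segment hA hB, lambertStateAfter_lambertFlow_succ hs h1 h2 hτ m]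
    congr 1
    have htR : (lambertInstant G ε ξs z (k + (m + 1))).toReal =
        (lambertInstant G ε (fun n => ξs (n + k)) (lambertFlow G ε ξs z s) (m + 1)).toReal + s := by
      rw [← hinst, ENNReal.toReal_add hfin' ENNReal.ofReal_ne_top, ENNReal.toReal_ofReal hs]
    rw [htR]
    ring

end LRestart

end Summit.AtomisticToContinuum.HydrodynamicLimit.Theorems
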